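import Summits.Schanuel.Schanuel.Theorems.ZilberEacSuperellipticPolyFibres
import Summits.Schanuel.Schanuel.Theorems.ZilberEacConicPolyFibre
import HarnessLib

/-!
# Arbitrary base branches, XLVIII: `y₀ = R(x₀)` over EVERY curve `x₁^k = P(x₀)` — case ∧ dense

HONEST FRAMING.  Cell `pub-schanuel` (Zilber's Exponential-Algebraic Closedness, case ladder;
host summit Schanuel), seat 2, gen 29.  Packaging of file XXXVII (all `(k, deg P)` with
`deg P ≠ k ∨ k ≥ 3`, by growth along a sheet) and file XLVII (the conics `k = deg P = 2`, by
THEOREM T): **`unprojectedDensityQuestion_cyclicCover_polyFibre_x₀`** — for every `k ≥ 2`, every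
monic `P` of degree `≥ 1` with a simple root and every non-constant `R`, the surface
`{x₁^k − P(x₀) = 0, y₀ = R(x₀)}` is in Mantova–Masser's case AND has Zariski-dense exponential
points.  No exception.  Decided instances of an OPEN question (Mantova–Masser, PLMS 2024 §1 p. 5);
EC(3,2) OPEN; NOT Schanuel's conjecture (neither used nor implied); EAC ⇏ SC.
-/

noncomputable section

open Filter Topology Set Complex MvPolynomial
open Literature.NumberTheory.Transcendental Literature.ModelTheory.Zilber
open Literature.ModelTheory.ExponentialFields

set_option linter.dupNamespace false

namespace Summit.Schanuel.Schanuel.Theorems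

section CyclicCover

variable (P : Polynomial ℂ)

/-- **`y₀ = R(x₀)` over the conics: case ∧ dense** (`P` monic of degree `2` with a simple root,
`R` non-constant), in plain coordinates. [cite: MantovaMasser2023, §1 Further remarks, p. 5 (the
question, open in general)] (new) -/
theorem unprojectedDensityQuestion_conic_polyFibre_x₀ (R : Polynomial ℂ) (hR : 1 ≤ R.natDegree)
    (hP : P.Monic) (h2 : P.natDegree = 2) {r : ℂ} (hr : P.IsRoot r)
    (hr1 : P.derivative.eval r ≠ 0) :
    MMCaseDimPiOneFree {w : Fin 2 ⊕ Fin 2 → ℂ |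
        w (Sum.inl 1) ^ 2 - P.eval (w (Sum.inl 0)) = 0 ∧ w (Sum.inr 0) = R.eval (w (Sum.inl 0))} ∧
      UnprojectedDense {w : Fin 2 ⊕ Fin 2 → ℂ |
        w (Sum.inl 1) ^ 2 - P.eval (w (Sum.inl 0)) = 0 ∧ w (Sum.inr 0) = R.eval (w (Sum.inl 0))} := by
  classical
  have hP0 : P ≠ 0 := by
    rintro rfl
    simp at hr1
  have hR0 : R ≠ 0 := by
    rintro rfl
    simp at hR
  have hcase : MMCaseDimPiOneFree {w : Fin 2 ⊕ Fin 2 → ℂ |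
      MvPolynomial.eval ![w (Sum.inl 0), w (Sum.inl 1)]
          (X 1 ^ 2 - Polynomial.aeval (X 0 : MvPolynomial (Fin 2) ℂ) P) = 0 ∧
      w (Sum.inr 0) = MvPolynomial.eval ![w (Sum.inl 0), w (Sum.inl 1)]
        (Polynomial.aeval (X 0 : MvPolynomial (Fin 2) ℂ) R)} := by
    refine mmCase_curveGraphFibre (irreducible_superellipticMv P (by omega) hr hr1) ?_
      (superelliptic_not_on_line P le_rfl hP0)
    obtain ⟨x₀, hx₀⟩ := R.roots.toFinset.exists_notMem
    rw [Multiset.mem_toFinset, Polynomial.mem_roots hR0] at hx₀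
    obtain ⟨y, hy⟩ := IsAlgClosed.exists_pow_nat_eq (P.eval x₀) (by norm_num : 0 < 2)
    refine ⟨![x₀, y], by rw [eval_superellipticMv]; simp [hy], ?_⟩
    rw [eval_polynomial_aeval_X]
    simpa using hx₀
  have e : {w : Fin 2 ⊕ Fin 2 → ℂ |
        MvPolynomial.eval ![w (Sum.inl 0), w (Sum.inl 1)]
            (X 1 ^ 2 - Polynomial.aeval (X 0 : MvPolynomial (Fin 2) ℂ) P) = 0 ∧
        w (Sum.inr 0) = MvPolynomial.eval ![w (Sum.inl 0), w (Sum.inl 1)]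
          (Polynomial.aeval (X 0 : MvPolynomial (Fin 2) ℂ) R)} =
      {w : Fin 2 ⊕ Fin 2 → ℂ |
        w (Sum.inl 1) ^ 2 - P.eval (w (Sum.inl 0)) = 0 ∧ w (Sum.inr 0) = R.eval (w (Sum.inl 0))} := by
    ext w
    simp only [Set.mem_setOf_eq, eval_superellipticMv, eval_polynomial_aeval_X, Matrix.cons_val_zero,
      Matrix.cons_val_one]
  have h : MMCaseDimPiOneFree _ ∧ UnprojectedDense _ :=
    ⟨hcase, unprojectedDense_conic_polyFibre_x₀ P R hR hP h2 hr hr1⟩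
  rw [e] at h
  exact h

/-- **`y₀ = R(x₀)` over every `x₁^k = P(x₀)`: case ∧ dense, no exception** (`k ≥ 2`, `P` monic of
degree `≥ 1` with a simple root, `R` non-constant). [cite: MantovaMasser2023, §1 Further remarks,
p. 5 (the question, open in general)] (new) -/
theorem unprojectedDensityQuestion_cyclicCover_polyFibre_x₀ (R : Polynomial ℂ)
    (hR : 1 ≤ R.natDegree) {k : ℕ} (hk : 2 ≤ k) (hP : P.Monic) (hM : 1 ≤ P.natDegree) {r : ℂ}
    (hr : P.IsRoot r) (hr1 : P.derivative.eval r ≠ 0) :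
    MMCaseDimPiOneFree {w : Fin 2 ⊕ Fin 2 → ℂ |
        w (Sum.inl 1) ^ k - P.eval (w (Sum.inl 0)) = 0 ∧ w (Sum.inr 0) = R.eval (w (Sum.inl 0))} ∧
      UnprojectedDense {w : Fin 2 ⊕ Fin 2 → ℂ |
        w (Sum.inl 1) ^ k - P.eval (w (Sum.inl 0)) = 0 ∧ w (Sum.inr 0) = R.eval (w (Sum.inl 0))} := by
  by_cases hexc : P.natDegree ≠ k ∨ 3 ≤ k
  · exact unprojectedDensityQuestion_superelliptic_polyFibre_x₀ P R hR hk hP hM hr hr1 hexc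
  · push Not at hexc
    obtain ⟨hMk, hk3⟩ := hexc
    have hk2 : k = 2 := by omega
    subst hk2
    exact unprojectedDensityQuestion_conic_polyFibre_x₀ P R hR hP hMk hr hr1

/-- Example: `{x₁² = x₀² + 1, y₀ = x₀}` (the unit hyperbola with the fibre `y₀ = x₀`): case ∧
dense. [cite: MantovaMasser2023, §1 Further remarks, p. 5 (the question, open in general)] (new) -/
theorem unprojectedDensityQuestion_unitHyperbola_fibre_x₀ :
    MMCaseDimPiOneFree {w : Fin 2 ⊕ Fin 2 → ℂ |
        w (Sum.inl 1) ^ 2 - (Polynomial.X ^ 2 + 1 : Polynomial ℂ).eval (w (Sum.inl 0)) = 0 ∧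
        w (Sum.inr 0) = (Polynomial.X : Polynomial ℂ).eval (w (Sum.inl 0))} ∧
      UnprojectedDense {w : Fin 2 ⊕ Fin 2 → ℂ |
        w (Sum.inl 1) ^ 2 - (Polynomial.X ^ 2 + 1 : Polynomial ℂ).eval (w (Sum.inl 0)) = 0 ∧
        w (Sum.inr 0) = (Polynomial.X : Polynomial ℂ).eval (w (Sum.inl 0))} := by
  have hmonic : (Polynomial.X ^ 2 + 1 : Polynomial ℂ).Monic := by
    simpa using Polynomial.monic_X_pow_add_C (1 : ℂ) (by norm_num : (2 : ℕ) ≠ 0)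
  have hdeg : (Polynomial.X ^ 2 + 1 : Polynomial ℂ).natDegree = 2 := by
    simpa using Polynomial.natDegree_X_pow_add_C (n := 2) (r := (1 : ℂ))
  have hroot : (Polynomial.X ^ 2 + 1 : Polynomial ℂ).IsRoot I := by
    simp [Polynomial.IsRoot, Complex.I_sq]
  have hder : (Polynomial.derivative (Polynomial.X ^ 2 + 1 : Polynomial ℂ)).eval I ≠ 0 := by
    rw [Polynomial.derivative_add, Polynomial.derivative_one, Polynomial.derivative_X_pow, add_zero,
      Polynomial.eval_mul, Polynomial.eval_C, Polynomial.eval_pow, Polynomial.eval_X]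
    simp [Complex.I_ne_zero]
  exact unprojectedDensityQuestion_conic_polyFibre_x₀ _ Polynomial.X (by simp) hmonic hdeg hroot hder

end CyclicCover

end Summit.Schanuel.Schanuel.Theorems

end
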